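import Mathlib.Geometry.Manifold.Diffeomorph
import Mathlib.Geometry.Manifold.Instances.Real
import Literature.Topology.FourManifolds.BranchedDoubleQuotient
import Literature.Geometry.Kaehler.RealStructure
import HarnessLib

/-!
# Uniqueness of the Arnold–Rokhlin smoothing of `X/conj` (named fact)

Topic `Topology/FourManifolds`; namespace `Literature.Topology.FourManifolds`. A FACT file
(D-0014) companion to `ArnoldRokhlinQuotient.lean`, which vendors the EXISTENCE half
(`Finashin1996_conjQuotient_exists`) of the classical statement and says: "Only EXISTENCE is
vendored; uniqueness up to isotopy/diffeomorphism (DK2000 §3.2; Bredon 1972 VI.2) is a separate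
statement." This file records that separate statement, for route
`SmoothPoincare4/RealQuotientSpheres`: it is what makes the route's target
`Summit.SmoothPoincare4.SmoothPoincare4.Theses.RealQuotientSpheres.RqExotic` ("EVERY standard-model
quotient of `(X, σ)` is not diffeomorphic to `S⁴`") the negation of its kill switch
`…RealQuotientSpheres.RqStandard` ("SOME standard-model quotient of `(X, σ)` is diffeomorphic to
`S⁴`"), as the route's refuter reviews argue on paper (notes on stmt-SmoothPoincare4-7151/7153).

Source, read at page level: Degtyarev–Kharlamov, *Topological properties of real algebraic
varieties: du côté de chez Rokhlin*, Russian Math. Surveys 55:4 (2000) = arXiv:math/0004134,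
§3.2 "The orbit space of the complex conjugation", ¶1 (arXiv p. 14, ll. 21–26), verbatim:
"Another phenomenon specific for surfaces is the fact that the fixed point set of the complex
conjugation has codimension 2. Hence, the quotient `X/conj` is a manifold; moreover, one can
easily see that, up to isotopy, there is a unique smooth structure on `X/conj` such that the
projection `X → X/conj` is a double covering branched over `ℝX`." (The standard argument:
equivariant tubular neighbourhoods of `X_ℝ`, Bredon, *Introduction to compact transformation
groups* (1972), VI.2, are unique up to equivariant isotopy, and off `X_ℝ` the structure is forced
by the local-diffeomorphism clause.)

Dictionary (as in `ArnoldRokhlinQuotient.lean`). "Real surface" = compact complex-analytic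
surface `X` (`ChartedSpace (Fin 2 → ℂ) X`, `IsManifold 𝓘(ℂ, Fin 2 → ℂ) ω X`, Hausdorff, second
countable) with an anti-holomorphic involution `σ` (`Literature.Geometry.Kaehler.IsAntiholomorphic`
+ `σ ∘ σ = id`); "smooth structure on `X/conj` such that the projection is a double covering
branched over `ℝX`" = a Hausdorff second-countable `C^∞` 4-manifold `Y` with `q : X → Y`
satisfying `IsBranchedDoubleQuotient σ q` (`BranchedDoubleQuotient.lean`). Two such `(Y₁, q₁)`,
`(Y₂, q₂)` are two smooth structures on the one topological space `X/σ` (both `qᵢ` are quotient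
maps with the same fibres, so `Y₁ ≃ₜ Y₂` canonically over `X`); the print says they are isotopic,
and we record only the consequence used downstream: `Y₁` and `Y₂` are diffeomorphic (WEAKER than
the print, never stronger). No real point is assumed (for `X_ℝ = ∅` both are the unbranched double
cover and the statement is the uniqueness of the quotient smooth structure of a free involution).

## Mathlib / tree search

Mathlib: no quotient manifolds / branched covers (`lean search 'branched|Branched'`: prose only).
Tree: `IsBranchedDoubleQuotient` (definition; its docstring defers "UNIQUENESS of `Y` up to
diffeomorphism (Bredon VI.2)"), `Finashin1996_conjQuotient_exists` (existence, accepted p57961),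
`Literature.AlgebraicTopology.FundamentalGroup.armstrong1968_orbitSpace_simplyConnected` (π₁ of
the orbit space). Nothing states uniqueness (`lean search 'IsBranchedDoubleQuotient'`: the two
files above and the route file only).

## References

* [DegtyarevKharlamov2000] A. Degtyarev, V. Kharlamov, Russian Math. Surveys 55 (2000)
  (arXiv:math/0004134), §3.2 ¶1.
* [Finashin1996] S. Finashin, J. reine angew. Math. 481 (1996) 55–71 (arXiv:dg-ga/9506007), §1 ¶2
  ("The quotient `Y` inherits from `X` … a smooth structure").
* [Bredon1972] G. E. Bredon, *Introduction to compact transformation groups*, Academic Press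
  (1972), VI.2 (equivariant tubular neighbourhoods; not held — mechanism only, not cited as the
  statement's source).
-/

noncomputable section

open scoped Manifold ContDiff
open Set Function

namespace Literature.Topology.FourManifolds

/-- **Degtyarev–Kharlamov 2000, §3.2 ¶1 (uniqueness of the smooth quotient `X/conj`)**: "up to
isotopy, there is a unique smooth structure on `X/conj` such that the projection `X → X/conj` is a
double covering branched over `ℝX`."

Lean form (diffeomorphism consequence only). For a compact complex surface `X` (Hausdorff, second
countable, charts in `ℂ²`, analytic) with an anti-holomorphic involution `σ`, and two standard-model
branched double quotients `q₁ : X → Y₁`, `q₂ : X → Y₂` of `X` by `σ` (`Yᵢ` Hausdorff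
second-countable `C^∞` 4-manifolds modelled on `ℝ⁴`, `IsBranchedDoubleQuotient σ qᵢ`), the
manifolds `Y₁` and `Y₂` are diffeomorphic. Companion of the existence fact
`Finashin1996_conjQuotient_exists` (same hypotheses on `(X, σ)`, minus the real point). Serves
route `SmoothPoincare4/RealQuotientSpheres`: with it, `RqExotic ↔ ¬ RqStandard`.
[cite: DegtyarevKharlamov2000, §3.2 ¶1 (arXiv:math/0004134 p. 14, ll. 21–26)] -/
def DegtyarevKharlamov2000_conjQuotient_unique : Prop :=
  ∀ (X : Type) [TopologicalSpace X] [T2Space X] [SecondCountableTopology X] [CompactSpace X]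
    [ChartedSpace (Fin 2 → ℂ) X] [IsManifold 𝓘(ℂ, Fin 2 → ℂ) ω X] (σ : X → X),
    Literature.Geometry.Kaehler.IsAntiholomorphic 𝓘(ℂ, Fin 2 → ℂ) 𝓘(ℂ, Fin 2 → ℂ) σ →
    (∀ x, σ (σ x) = x) →
    ∀ (Y₁ : Type) [TopologicalSpace Y₁] [T2Space Y₁] [SecondCountableTopology Y₁]
      [ChartedSpace (EuclideanSpace ℝ (Fin 4)) Y₁] [IsManifold (𝓡 4) ∞ Y₁] (q₁ : X → Y₁)
      (Y₂ : Type) [TopologicalSpace Y₂] [T2Space Y₂] [SecondCountableTopology Y₂]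
      [ChartedSpace (EuclideanSpace ℝ (Fin 4)) Y₂] [IsManifold (𝓡 4) ∞ Y₂] (q₂ : X → Y₂),
      IsBranchedDoubleQuotient σ q₁ → IsBranchedDoubleQuotient σ q₂ →
      Nonempty (Y₁ ≃ₘ⟮𝓡 4, 𝓡 4⟯ Y₂)

end Literature.Topology.FourManifolds

end
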